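import Mathlib
import Literature.Computability.AlgebraicComplexity.PermanentIrreducible
import Literature.Computability.AlgebraicComplexity.StandardFamiliesProofs
import Summits.ValiantsHypothesis.ValiantsHypothesis.Theorems.DivisionGapPerCofactorDegreeReductionStubNegativeCompensation

/-!
# Crux `DivisionGap.PerCofactorDegreeReduction` (stmt-ValiantsHypothesis-15046), line `Sketch` —
# stub `stub_positivityThreshold`: the positivity threshold of the permanent is `n + 2` for all `n ≥ 2`

**Theorem (`stub_positivityThreshold`).** For every `n ≥ 2` there is a SIGNED real cofactor
`q ∈ ℝ[x_ij]` (`n × n` variables) of total degree `≤ n + 2` — some coefficient of `q` is `< 0` —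
such that every coefficient of `per_n · q` is nonnegative.  Together with the landed
`stub_automaticPositivity` (`deg q ≤ n + 1 ∧ per_n · q ≥ 0 ⇒ q ≥ 0`) this pins the positivity
threshold `d*(n) = n + 2` for every `n ≥ 2` (kernel-checked before only at `n = 2, 3`:
`Negative/AutomaticPositivityTight`, `Negative/SignedCofactorThree`).

## Proof

* **Engine** (`exists_signed_cofactor`).  Let `m` be an exponent and `τ` a self-map of the
  permutations with `τ σ ≠ σ` and `μ_{τ σ} ≤ m + μ_σ` for every `σ` (a SECOND permutation monomial
  below `m + μ_σ`).  Put `P := Σ_σ x^{(m + μ_σ) − μ_{τ σ}}` and `q := P − x^m`.  Every coefficient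
  of `P` is `≥ 0`; `P` vanishes at `m`, because `(m + μ_σ) − μ_π = m` with `μ_π ≤ m + μ_σ` forces
  `μ_σ = μ_π`, i.e. `σ = π` (`permMonomial_injective`; `add_tsub_permMonomial_ne`), while
  `τ σ ≠ σ`; so `coeff m q = −1`, and `q` agrees with `P` away from `m`.  Degrees:
  `deg ((m + μ_σ) − μ_{τ σ}) + n = deg m + n` (`degree_permMonomial`), so `deg q ≤ deg m`.
  Positivity of `per_n · q`, via `NegativeCompensation.coeff_perPoly_mul`
  (`coeff d (per_n · q) = Σ_π [μ_π ≤ d] · q_{d − μ_π}`): if `d` is not of the form `m + μ_ρ`, no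
  `d − μ_π` equals `m`, so every term is a coefficient of `P`, `≥ 0`; if `d = m + μ_ρ`, then by
  `NegativeCompensation.coeff_add_permMonomial_perPoly_mul` the coefficient is
  `q_m + Σ_{π ≠ ρ} [μ_π ≤ m + μ_ρ] · q_{(m + μ_ρ) − μ_π} = −1 + (terms ≥ 0)`, and the term
  `π = τ ρ` is `P_{(m + μ_ρ) − μ_{τ ρ}} ≥ 1` (the `σ = ρ` summand of `P`).
* **Instance** (`stub_positivityThreshold`).  For `n ≥ 2` let `a = n − 2 ≠ b = n − 1` and
  `m := μ_id + e_{(a, b)} + e_{(b, a)}` (the identity matrix plus the anti-diagonal of the last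
  `2 × 2` block; `deg m = n + 2` by `degree_permMonomial`, `Finsupp.degree_single`), and
  `τ σ := swap a b` if `σ = id`, `τ σ := id` otherwise.  Then `τ σ ≠ σ` (`swap a b ≠ id` as
  `a ≠ b`, `Equiv.swap_eq_one_iff`), and `μ_{τ σ} ≤ m`: `μ_id ≤ m` trivially and
  `μ_{swap a b} ≤ m` cell by cell (`permMonomial_swap_le`: column `a` carries row `b`, covered by
  `e_{(b, a)}`; column `b` carries row `a`, covered by `e_{(a, b)}`; the other columns are
  diagonal).

Design: no definitions (`m`, `τ`, `q` are built inside the proofs; the engine is stated as an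
existence lemma); everything over `Fin n`.  Leans on Mathlib, the tree file
`Literature/Computability/AlgebraicComplexity/PermanentIrreducible.lean` (`permMonomial`,
`permMonomial_apply`, `permMonomial_injective`, `rowCount_permMonomial`) and the landed stub file
`DivisionGapPerCofactorDegreeReductionStubNegativeCompensation.lean` (`coeff_perPoly_mul`,
`coeff_add_permMonomial_perPoly_mul`).
-/

noncomputable section

-- `Summit.ValiantsHypothesis.ValiantsHypothesis.…` is the tree's mandated single-conjunct layout
-- (Problem = Summit), so the duplicated namespace component is intended.
set_option linter.dupNamespace false

namespace Summit.ValiantsHypothesis.ValiantsHypothesis.Theorems.DivisionGap.PerCofactorDegreeReduction.PositivityThreshold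

open MvPolynomial Literature.Computability.AlgebraicComplexity
open scoped BigOperators

variable {n : ℕ}

/-! ### Degrees of exponent vectors -/

/-- A permutation monomial of `per_n` has degree `n`: one variable from each row
(`rowCount_permMonomial`). [folklore] -/
theorem degree_permMonomial (ρ : Equiv.Perm (Fin n)) : (permMonomial ρ).degree = n := by
  rw [Finsupp.degree_eq_sum, Fintype.sum_prod_type]
  have h : ∀ r : Fin n, ∑ c, permMonomial ρ (r, c) = 1 := fun r => rowCount_permMonomial ρ r
  simp_rw [h]
  simp

/-- The total degree of a monomial is at most the degree of its exponent. [folklore] -/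
theorem totalDegree_monomial_le_degree (s : (Fin n × Fin n) →₀ ℕ) (c : ℝ) :
    (monomial s c).totalDegree ≤ s.degree := by
  rw [Finsupp.degree_apply]
  exact totalDegree_monomial_le s c

/-- If `μ_π ≤ m + μ_ρ` and `π ≠ ρ`, then `(m + μ_ρ) − μ_π ≠ m`: otherwise adding back `μ_π` gives
`m + μ_ρ = m + μ_π`, so `μ_ρ = μ_π` and `ρ = π` (`permMonomial_injective`). [folklore] -/
theorem add_tsub_permMonomial_ne (m : (Fin n × Fin n) →₀ ℕ) {ρ π : Equiv.Perm (Fin n)}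
    (hle : permMonomial π ≤ m + permMonomial ρ) (hne : π ≠ ρ) :
    m + permMonomial ρ - permMonomial π ≠ m := by
  intro h
  have h2 := congrArg (· + permMonomial π) h
  simp only [tsub_add_cancel_of_le hle] at h2
  exact hne (permMonomial_injective (add_left_cancel h2)).symm

/-! ### The engine: a second permutation monomial below every `m + μ_σ` -/

/-- **Engine.**  Let `m` be an exponent and `τ` a self-map of the permutations with `τ σ ≠ σ` and
`μ_{τ σ} ≤ m + μ_σ` for all `σ`.  Then `q := Σ_σ x^{(m + μ_σ) − μ_{τ σ}} − x^m` has total degree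
`≤ deg m`, `coeff m q = −1`, and `per_n · q ≥ 0` coefficientwise: by `coeff_perPoly_mul` the
negative monomial `−x^m` of `q` is seen by `per_n · q` only at the exponents `m + μ_ρ`, where
(`coeff_add_permMonomial_perPoly_mul`) it contributes `−1` against the term `π = τ ρ`, which is the
coefficient `≥ 1` of the positive part at `(m + μ_ρ) − μ_{τ ρ}` (its `σ = ρ` summand); all other
terms are coefficients of the positive part. [prime-walk-positivizer, K2 window] -/
theorem exists_signed_cofactor (m : (Fin n × Fin n) →₀ ℕ)
    (τ : Equiv.Perm (Fin n) → Equiv.Perm (Fin n)) (hne : ∀ σ, τ σ ≠ σ)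
    (hle : ∀ σ, permMonomial (τ σ) ≤ m + permMonomial σ) :
    ∃ q : MvPolynomial (Fin n × Fin n) ℝ, q.totalDegree ≤ m.degree ∧ coeff m q = -1 ∧
      ∀ d, 0 ≤ coeff d (perPoly (Fin n) ℝ * q) := by
  -- the positive part `P`
  obtain ⟨P, hP⟩ : ∃ P : MvPolynomial (Fin n × Fin n) ℝ,
      P = ∑ σ, monomial (m + permMonomial σ - permMonomial (τ σ)) 1 := ⟨_, rfl⟩
  have hPcoeff : ∀ e, coeff e P =
      ∑ σ, if m + permMonomial σ - permMonomial (τ σ) = e then (1 : ℝ) else 0 := fun e => by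
    rw [hP, coeff_sum]
    simp only [coeff_monomial]
  -- all coefficients of `P` are nonnegative
  have hP0 : ∀ e, 0 ≤ coeff e P := fun e => by
    rw [hPcoeff]
    exact Finset.sum_nonneg fun σ _ => by split_ifs <;> norm_num
  -- `P` vanishes at `m`
  have hPm : coeff m P = 0 := by
    rw [hPcoeff]
    exact Finset.sum_eq_zero fun σ _ => if_neg (add_tsub_permMonomial_ne m (hle σ) (hne σ))
  -- `P` is `≥ 1` at `(m + μ_ρ) − μ_{τ ρ}` (the `σ = ρ` summand)
  have hP1 : ∀ ρ, 1 ≤ coeff (m + permMonomial ρ - permMonomial (τ ρ)) P := fun ρ => by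
    rw [hPcoeff, ← Finset.add_sum_erase _ _ (Finset.mem_univ ρ), if_pos rfl]
    have h0 : 0 ≤ ∑ σ ∈ Finset.univ.erase ρ,
        (if m + permMonomial σ - permMonomial (τ σ) = m + permMonomial ρ - permMonomial (τ ρ)
          then (1 : ℝ) else 0) :=
      Finset.sum_nonneg fun σ _ => by split_ifs <;> norm_num
    linarith
  -- the cofactor `q := P − x^m`
  have hqm : coeff m (P - monomial m 1) = -1 := by
    rw [coeff_sub, coeff_monomial, if_pos rfl, hPm]
    norm_num
  have hq : ∀ e, e ≠ m → coeff e (P - monomial m 1) = coeff e P := fun e he => by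
    rw [coeff_sub, coeff_monomial, if_neg fun h => he h.symm, sub_zero]
  refine ⟨P - monomial m 1, ?_, hqm, fun d => ?_⟩
  · -- degree
    refine (totalDegree_sub _ _).trans (max_le ?_ (totalDegree_monomial_le_degree m 1))
    rw [hP]
    refine totalDegree_finsetSum_le fun σ _ => (totalDegree_monomial_le_degree _ _).trans ?_
    have h := congrArg Finsupp.degree (tsub_add_cancel_of_le (hle σ))
    rw [map_add, map_add, degree_permMonomial, degree_permMonomial] at h
    omega
  · -- positivity of `per_n · q` at `d`
    by_cases hd : ∃ ρ, d = m + permMonomial ρ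
    · obtain ⟨ρ, rfl⟩ := hd
      rw [NegativeCompensation.coeff_add_permMonomial_perPoly_mul, hqm,
        ← Finset.add_sum_erase _ _ (Finset.mem_erase.mpr ⟨hne ρ, Finset.mem_univ _⟩),
        if_pos (hle ρ), hq _ (add_tsub_permMonomial_ne m (hle ρ) (hne ρ))]
      have h1 := hP1 ρ
      have h0 : 0 ≤ ∑ π ∈ (Finset.univ.erase ρ).erase (τ ρ),
          (if permMonomial π ≤ m + permMonomial ρ then
            coeff (m + permMonomial ρ - permMonomial π) (P - monomial m 1) else 0) := by
        refine Finset.sum_nonneg fun π hπ => ?_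
        split_ifs with h
        · have hπρ : π ≠ ρ := Finset.ne_of_mem_erase (Finset.mem_of_mem_erase hπ)
          rw [hq _ (add_tsub_permMonomial_ne m h hπρ)]
          exact hP0 _
        · exact le_rfl
      linarith
    · rw [NegativeCompensation.coeff_perPoly_mul]
      refine Finset.sum_nonneg fun π _ => ?_
      split_ifs with h
      · rw [hq]
        · exact hP0 _
        · intro hdm
          exact hd ⟨π, by rw [← hdm, tsub_add_cancel_of_le h]⟩
      · exact le_rfl

/-! ### The instance: identity plus the anti-diagonal of a `2 × 2` block -/

/-- The transposition monomial `μ_{swap a b}` lies below `μ_id + e_{(a, b)} + e_{(b, a)}`: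
column `a` of `swap a b` carries row `b` (covered by `e_{(b, a)}`), column `b` carries row `a`
(covered by `e_{(a, b)}`), and every other column is diagonal (covered by `μ_id`). [folklore] -/
theorem permMonomial_swap_le (a b : Fin n) :
    permMonomial (Equiv.swap a b) ≤
      permMonomial 1 + Finsupp.single (a, b) 1 + Finsupp.single (b, a) 1 := by
  rw [Finsupp.le_def]
  rintro ⟨r, c⟩
  simp only [Finsupp.coe_add, Pi.add_apply, permMonomial_apply, Equiv.Perm.coe_one, id_eq,
    Finsupp.single_apply, Prod.mk.injEq]
  rcases eq_or_ne c a with rfl | hca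
  · -- column `a`: row `b`, covered by the summand `e_{(b, a)}`
    rw [Equiv.swap_apply_left]
    refine le_add_left (le_of_eq ?_)
    simp
  · rcases eq_or_ne c b with rfl | hcb
    · -- column `b`: row `a`, covered by the summand `e_{(a, b)}`
      rw [Equiv.swap_apply_right]
      refine le_add_right (le_add_left (le_of_eq ?_))
      simp
    · -- any other column: diagonal, covered by `μ_id`
      rw [Equiv.swap_apply_of_ne_of_ne hca hcb]
      exact le_self_add.trans le_self_add

/-! ### The stub -/

/-- **stub_positivityThreshold — the positivity threshold of the permanent is exactly `n + 2` for
all `n ≥ 2`.**  There is a SIGNED real `q` of degree `≤ n + 2` with `per_n · q ≥ 0`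
coefficientwise (so, with `stub_automaticPositivity`, `d*(n) = n + 2`).  Construction:
`m := μ_id + e_{(n−2, n−1)} + e_{(n−1, n−2)}` (degree `n + 2`), `τ(id) := swap (n−2) (n−1)`,
`τ(σ) := id` for `σ ≠ id` (both monomials lie below `m`, `permMonomial_swap_le`), and
`q := Σ_σ x^{(m + μ_σ) − μ_{τ(σ)}} − x^m` (`exists_signed_cofactor`): `coeff m q = −1`, and in
`per_n · q` the monomial `−x^m` is compensated at each `m + μ_ρ` by the term `τ = τ(ρ)`, `σ = ρ`.
[prime-walk-positivizer, K2 window] -/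
theorem stub_positivityThreshold (n : ℕ) (hn : 2 ≤ n) :
    ∃ q : MvPolynomial (Fin n × Fin n) ℝ, q.totalDegree ≤ n + 2 ∧ (∃ m, coeff m q < 0) ∧
      ∀ m, 0 ≤ coeff m (perPoly (Fin n) ℝ * q) := by
  -- the last two indices
  set a : Fin n := ⟨n - 2, by omega⟩ with ha
  set b : Fin n := ⟨n - 1, by omega⟩ with hb
  have hab : a ≠ b := by
    rw [ha, hb, Ne, Fin.mk.injEq]
    omega
  -- the exponent `m` and the second-permutation map `τ`
  set m : (Fin n × Fin n) →₀ ℕ :=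
    permMonomial 1 + Finsupp.single (a, b) 1 + Finsupp.single (b, a) 1 with hm
  have hdeg : m.degree = n + 2 := by
    rw [hm, map_add, map_add, degree_permMonomial, Finsupp.degree_single, Finsupp.degree_single]
  obtain ⟨τ, hτ⟩ : ∃ τ : Equiv.Perm (Fin n) → Equiv.Perm (Fin n),
      ∀ σ, τ σ = if σ = 1 then Equiv.swap a b else 1 := ⟨_, fun σ => rfl⟩
  have hne : ∀ σ, τ σ ≠ σ := fun σ => by
    rw [hτ]
    by_cases hσ : σ = 1
    · rw [if_pos hσ, hσ, Ne, Equiv.swap_eq_one_iff]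
      exact hab
    · rw [if_neg hσ]
      exact fun h => hσ h.symm
  have hle : ∀ σ, permMonomial (τ σ) ≤ m + permMonomial σ := fun σ => by
    refine le_add_right ?_
    rw [hτ]
    by_cases hσ : σ = 1
    · rw [if_pos hσ, hm]
      exact permMonomial_swap_le a b
    · rw [if_neg hσ, hm]
      exact le_self_add.trans le_self_add
  obtain ⟨q, hqdeg, hqm, hpos⟩ := exists_signed_cofactor m τ hne hle
  exact ⟨q, hdeg ▸ hqdeg, ⟨m, by rw [hqm]; norm_num⟩, hpos⟩

end Summit.ValiantsHypothesis.ValiantsHypothesis.Theorems.DivisionGap.PerCofactorDegreeReduction.PositivityThreshold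

end
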